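import Summits.CriticalPhenomena.PercolationContinuityZ3.Theorems.Transplant.SkelPhiParaRunFrame
import HarnessLib

/-!
# N1 (the `{±1}` node), LEVEL 1: DISPLACEMENTS IN THE RUN FRAMES — a planar `φ`-displacement of at most `d` in each coordinate (e.g. a kit centre within
# graph distance `d` of a contact, `φ` being 1-Lipschitz) reads as at most `d` ALONG and at most `d + 1` ACROSS in the run frames `runX/runY`
# (the transverse coordinate is `⌊σβ′/(n+|h|)⌋` and `|Δβ′| ≤ (n+|h|)·d`) — the unit conversion the params ledger needs for the schedule radius `R′`
# (window units) versus kit displacements (`φ`-rows)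

builds on p205010 (kernel theorem, internal audit signed; external expert review pending) — nothing in this file uses p205010; nothing here is a
claim about the open node `SamePDropOfSkeletonNeg`.
Lane `prim-bschramm`, seat `prim-bschramm-p1` (gen 11; recipe `HOME/prim-bschramm-p1/N1-RUN-RECORDS.md`); helper file (`--supports stmt-CriticalPhenomena-4575 --as helper`).
* `abs_shearCoord_sub_le_of_φ` (`|Δφ₀|, |Δφ₁| ≤ d ⇒ |Δβ′| ≤ (n+|h|)·d`);
* **`runX_disp_of_φ`**, **`runY_disp_of_φ`** (`⇒` along `≤ d`, across `≤ d + 1`);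
* **`runX_disp_of_mem_graphBall`**, **`runY_disp_of_mem_graphBall`** (`w' ∈ B_G(w, d)`, `Lip G φ`).
[cite: KozmaNitzan2024, §4 Lemma 10 Step IV (p. 20: the kit centre near the contact)] [cite: MartineauTassion2017, §4.3]
-/

noncomputable section

namespace Summit.CriticalPhenomena.PercolationContinuityZ3.Theorems.Transplant

namespace Skelφ

open Literature.Probability.Percolation Literature.Probability.LatticeModels SimpleGraph
open Literature.Barriers.CriticalPhenomena (graphBall)

variable {V : Type} {G : SimpleGraph V} {φ : V → Site 2}

/-- **`|Δβ′| ≤ (n + |h|)·d`** for two vertices whose planar positions differ by at most `d` in each coordinate. [folklore] -/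
theorem abs_shearCoord_sub_le_of_φ (c₀ : V) (n : ℕ) (h : ℤ) {w w' : V} {d : ℤ} (h0 : |φ w 0 - φ w' 0| ≤ d) (h1 : |φ w 1 - φ w' 1| ≤ d) :
    |shearCoord φ c₀ n h w - shearCoord φ c₀ n h w'| ≤ (shearUnit n h : ℤ) * d := by
  have e : shearCoord φ c₀ n h w - shearCoord φ c₀ n h w' = (n : ℤ) * (φ w 1 - φ w' 1) - h * (φ w 0 - φ w' 0) := by
    simp only [shearCoord_apply]; ring
  rw [e]
  refine (abs_sub _ _).trans ?_
  rw [abs_mul, abs_mul, Nat.abs_cast]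
  unfold shearUnit; push_cast [Int.natCast_natAbs]
  have hn : (0 : ℤ) ≤ n := by positivity
  nlinarith [abs_nonneg h, abs_nonneg (φ w 1 - φ w' 1), abs_nonneg (φ w 0 - φ w' 0)]

/-- **Displacement in the x-frame**: `|Δφ₀|, |Δφ₁| ≤ d` give `|Δ runX₀| ≤ d` and `|Δ runX₁| ≤ d + 1` (`1 ≤ n`, `σ = ±1`). [folklore] -/
theorem runX_disp_of_φ {n : ℕ} (hn : 1 ≤ n) (c₀ : V) (h : ℤ) {σ : ℤ} (hσ : σ = 1 ∨ σ = -1) {w w' : V} {d : ℤ}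
    (h0 : |φ w 0 - φ w' 0| ≤ d) (h1 : |φ w 1 - φ w' 1| ≤ d) :
    |runX φ c₀ n h σ w 0 - runX φ c₀ n h σ w' 0| ≤ d ∧ |runX φ c₀ n h σ w 1 - runX φ c₀ n h σ w' 1| ≤ d + 1 := by
  have hσ1 : |σ| = 1 := by rcases hσ with rfl | rfl <;> simp
  have hc := shearUnit_pos hn h
  constructor
  · rw [runX_zero, runX_zero, ← mul_sub, abs_mul, hσ1, one_mul]
    have e : relCoord φ c₀ 0 w - relCoord φ c₀ 0 w' = φ w 0 - φ w' 0 := by simp only [relCoord_apply]; ring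
    rw [e]; exact h0
  · rw [runX_one, runX_one]
    have h2 : |σ * shearCoord φ c₀ n h w - σ * shearCoord φ c₀ n h w'| ≤ (shearUnit n h : ℤ) * d := by
      rw [← mul_sub, abs_mul, hσ1, one_mul]; exact abs_shearCoord_sub_le_of_φ c₀ n h h0 h1
    have h3 := abs_ediv_sub_ediv_le hc h2
    have e : (shearUnit n h : ℤ) * d / (shearUnit n h : ℤ) = d := by rw [mul_comm]; exact Int.mul_ediv_cancel d hc.ne'
    rw [e] at h3; exact h3

/-- **Displacement in the y′-frame** (coordinates exchanged): `|Δ runY₀| ≤ d + 1`, `|Δ runY₁| ≤ d`. [folklore] -/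
theorem runY_disp_of_φ {n : ℕ} (hn : 1 ≤ n) (c₀ : V) (h : ℤ) {σ : ℤ} (hσ : σ = 1 ∨ σ = -1) {w w' : V} {d : ℤ}
    (h0 : |φ w 0 - φ w' 0| ≤ d) (h1 : |φ w 1 - φ w' 1| ≤ d) :
    |runY φ c₀ n h σ w 0 - runY φ c₀ n h σ w' 0| ≤ d + 1 ∧ |runY φ c₀ n h σ w 1 - runY φ c₀ n h σ w' 1| ≤ d := by
  obtain ⟨ha, hb⟩ := runX_disp_of_φ hn c₀ h hσ h0 h1
  refine ⟨?_, ?_⟩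
  · rw [runY_zero, runY_zero, ← runX_one φ c₀ n h σ w, ← runX_one φ c₀ n h σ w']; exact hb
  · rw [runY_one, runY_one, ← runX_zero φ c₀ n h σ w, ← runX_zero φ c₀ n h σ w']; exact ha

/-- **A vertex within graph distance `d`** is displaced by at most `(d, d+1)` in the x-frame (`Lip G φ`). [cite: KozmaNitzan2024, §4 Lemma 10 Step IV (p. 20)] -/
theorem runX_disp_of_mem_graphBall (hlip : Lip G φ) {n : ℕ} (hn : 1 ≤ n) (c₀ : V) (h : ℤ) {σ : ℤ} (hσ : σ = 1 ∨ σ = -1) {w w' : V} {d : ℕ}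
    (hw' : w' ∈ graphBall G w d) :
    |runX φ c₀ n h σ w' 0 - runX φ c₀ n h σ w 0| ≤ d ∧ |runX φ c₀ n h σ w' 1 - runX φ c₀ n h σ w 1| ≤ d + 1 :=
  runX_disp_of_φ hn c₀ h hσ (abs_sub_le_of_mem_graphBall hlip hw' 0) (abs_sub_le_of_mem_graphBall hlip hw' 1)

/-- **A vertex within graph distance `d`** is displaced by at most `(d+1, d)` in the y′-frame (`Lip G φ`). [cite: KozmaNitzan2024, §4 Lemma 10 Step IV (p. 20)] -/
theorem runY_disp_of_mem_graphBall (hlip : Lip G φ) {n : ℕ} (hn : 1 ≤ n) (c₀ : V) (h : ℤ) {σ : ℤ} (hσ : σ = 1 ∨ σ = -1) {w w' : V} {d : ℕ}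
    (hw' : w' ∈ graphBall G w d) :
    |runY φ c₀ n h σ w' 0 - runY φ c₀ n h σ w 0| ≤ d + 1 ∧ |runY φ c₀ n h σ w' 1 - runY φ c₀ n h σ w 1| ≤ d :=
  runY_disp_of_φ hn c₀ h hσ (abs_sub_le_of_mem_graphBall hlip hw' 0) (abs_sub_le_of_mem_graphBall hlip hw' 1)

end Skelφ

end Summit.CriticalPhenomena.PercolationContinuityZ3.Theorems.Transplant

end
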